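import Summits.QuantumFields.YangMills.Theorems.BalabanLadderROTOfKing
import HarnessLib

/-!
# Crux `ROT` (stmt-QuantumFields-20042) — `ROT` from King-invariance of UV limit points along RP-FLOORED unit maps (the PINNED closer)

Helper file (`--supports stmt-QuantumFields-20042 --as helper`; free-hands seat `ym-line-frs-p2` g19, answering director-ym R527-ym (d):
«would an RP-floor letter in `F4SubCurvatureDoor` break or ease its consumers?»).  `Theses.BalabanLadder.ROT` CARRIES the RP floor
`LowerBounds G r a` among its hypotheses and ✓`rot_of_kingLimit` discards it; this file records the PINNED closing form
`rot_of_kingLimitPinned`: King-invariance of the off-diagonal UV limit points is needed ONLY for unit maps `a` with `LowerBounds G r a` (and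
`MomentBounds6 G r a`).  Hence guarding the door's cruxes (`TrialityLimit`, `SubCurvatureKernel` and its children, `NPointStepF4`) by
`LowerBounds G r a` would NOT break the door's `closes` (it threads one more hypothesis) — a re-typing for the planner/director to decide,
not done here.  Same proof as ✓`rot_of_kingLimit` with the floor passed through.  0 sorry, standard axioms, no definition.

HONEST LABEL: bookkeeping; `ROT`, the door's cruxes and the Yang–Mills mass gap are NOT proved; no summit is proved by a line.
-/

set_option autoImplicit false

noncomputable section

open scoped SchwartzMap
open MeasureTheory Filter Topology
open Literature.MathematicalPhysics.QuantumFieldTheory Literature.MathematicalPhysics.QuantumLattice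
open Literature.MathematicalPhysics.AQFT Literature.Probability.LatticeModels
open Summit.QuantumFields.YangMills.Cruxes.OSLegsFromFemtoAndGap.DlrCollarTransfer
open Summit.QuantumFields.YangMills.Cruxes.OSLegsAtWeakCouplingC.Sketch
open Summit.QuantumFields.YangMills.Cruxes.OSLegsAtWeakCouplingC.Y2Bridge
open Summit.QuantumFields.YangMills.Theorems.NPointIsotropy.Negative (E4)
open Summit.QuantumFields.YangMills.Theorems.ROT

namespace Summit.QuantumFields.YangMills.Theorems.BalabanLadderROTOfKingPinned

/-- ★ **`ROT` from King-invariance of UV limit points along RP-floored unit maps** (the pinned form of ✓`rot_of_kingLimit`): if for every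
compact simple `G`, every `r` and every positive unit map `a → 0` carrying the RP floor `LowerBounds G r a` AND `MomentBounds6 G r a`, every
off-diagonal limit point of every admissible leg scheme is invariant on King's class at the Pythagorean angles, then
`Theses.BalabanLadder.ROT`. [C. King, CMP 103 (1986) Thm 2.4 — mechanism] -/
theorem rot_of_kingLimitPinned
    (hKL : ∀ (G : Type) [Group G] [TopologicalSpace G] [IsTopologicalGroup G] [CompactSpace G],
      IsCompactSimpleLieGroup G → letI : MeasurableSpace G := borel G; haveI : BorelSpace G := ⟨rfl⟩;
      ∀ (r : LatticeRep G) (a : ℝ → ℝ), (∀ β, 0 < a β) → Tendsto a atTop (𝓝 0) → LowerBounds G r a → MomentBounds6 G r a →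
        ∀ sch : SpeciesScheme (YMSpecies G), IsLegScheme a sch → ∃ r₀ : ℝ, 0 < r₀ ∧
          ∀ φ : ℕ → ℕ, Tendsto φ atTop atTop → ∀ S₁ : SchwingerFamily E4, OffDiagLimitAlong r sch φ S₁ →
            ∀ (n : ℕ), 2 ≤ n → ∀ F ∈ King.KingClass n r₀, ∀ θ ∈ (King.pythagoreanAngles : Set ℝ),
              S₁ n (linActMulti (planeRot (0 : Fin 3) θ) F) = S₁ n F) :
    Summit.QuantumFields.YangMills.Theses.BalabanLadder.ROT := by
  -- adapted from ✓`ROT.rot_of_kingLimit` (the `LowerBounds` guard is passed through instead of discarded)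
  intro G _ _ _ _ hG
  letI : MeasurableSpace G := borel G
  haveI : BorelSpace G := ⟨rfl⟩
  intro r a ha ha0 hLB hUV
  have hX : UVCompactAt r a := stub_uvExtract G hG r a ha ha0 hUV
  exact latticeRotWard_of_uvCompactAt_of_latticeKingWard r a hX _ King.dense_closure_pythagoreanAngles
    (latticeKingWard_of_uvCompactAt_of_limitsKingInvariant r a hX _ (hKL G hG r a ha ha0 hLB hUV))

end Summit.QuantumFields.YangMills.Theorems.BalabanLadderROTOfKingPinned

end
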